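import Literature.Analysis.UnboundedOperators.CyclicSpectralTheorem
import Literature.NumberTheory.ConnesConsani2024.ProlateWaveCyclicPairs
import HarnessLib

/-!
# Connes–Consani–Moscovici 2024, Theorem 2.1 (i): existence of the canonical form of a cyclic pair — DISCHARGE

RH-FREE corpus literature (operator theory at the archimedean place; NO positivity statement, NO
statement about zeros of `ζ`).  bears_on: W-C/W-P (CCM 2024 sequel row, no leaf role).  WHAT THIS
IS NOT: any claim about RH; nothing in this file bears on the truth of RH.

`CCM2024_thm_2_1_i_holds : CCM2024_thm_2_1_i` — the named fact of
`Literature.NumberTheory.ConnesConsani2024.ProlateWaveCyclicPairs` (A. Connes, C. Consani,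
H. Moscovici, *Zeta zeros and prolate wave operators*, Ann. Funct. Anal. 15 (2024), Thm 2.1 (i),
p. 6: every cyclic pair `(D, ξ)` has a canonical form `(μ, U)`, `U D U* =` multiplication by `s` on
`L²(ℝ, dμ)` with its natural domain, `U ξ = 1`) is now a theorem.  The printed proof is "the general
situation is described as follows by the spectral theorem" (p. 6, p0006:L3); accordingly the proof
here is the spectral theorem in multiplication-operator form, cyclic case
(`Literature.Analysis.UnboundedOperators.exists_unitary_mul_model`, Reed–Simon I Thm VIII.4),
instantiated at the data of `IsCyclicPair` and repackaged as `IsCanonicalForm`.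

## References
* A. Connes, C. Consani, H. Moscovici, *Zeta zeros and prolate wave operators*, Ann. Funct. Anal.
  15 (2024), arXiv:2310.18423, Thm 2.1. [ConnesConsaniMoscovici2024]
* M. Reed, B. Simon, *Methods of Modern Mathematical Physics I* (1980), Thm VIII.4. [ReedSimonI1980]
-/

noncomputable section

namespace Literature.NumberTheory.ConnesConsani2024

open _root_.MeasureTheory Literature.Analysis.UnboundedOperators

/-- **Theorem 2.1 (i) holds** (Connes–Consani–Moscovici 2024, p. 6: "the general situation is described
as follows by the spectral theorem"): every cyclic pair `(D, ξ)` has a canonical form. The proof IS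
the spectral theorem in multiplication-operator form for a self-adjoint operator with a cyclic vector,
`Literature.Analysis.UnboundedOperators.exists_unitary_mul_model` (Reed–Simon I Thm VIII.4 via the
resolvent `(D + i)⁻¹`, its scalar spectral measure and the cyclic isometry).
[cite: ConnesConsaniMoscovici2024, Thm. 2.1 (i) p. 6 (p0006:L7)] -/
theorem CCM2024_thm_2_1_i_holds : CCM2024_thm_2_1_i := by
  intro H _ _ _ D ξ hc
  obtain ⟨v, hv, hd⟩ := hc.exists_iterateSeq_dense
  obtain ⟨μ, U, hfin, huniv, hvec, hdom, hmap⟩ :=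
    exists_unitary_mul_model hc.isSelfAdjoint ξ v hv.1 hv.2 hd
  refine ⟨μ, U, ⟨⟨?_⟩, hvec, hdom, hmap⟩⟩
  rw [huniv, hc.norm_eq_one, one_pow, ENNReal.ofReal_one]

end Literature.NumberTheory.ConnesConsani2024
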